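import Summits.HubbardSuperconductivity.HubbardSuperconductivity.Theorems.WeakCouplingBCSKlLindhardEnclosureStraddle

/-!
# KL-MARGIN-SCAN reader (22) «kernel-lindhard-enclosure» — the 2-D SUBSTITUTION FLOOR (abstract core of the boundary FLOOR rule)

Kernel-agnostic analysis under the oriented boundary-floor rule `FloorBdrySoundOrd` (the last open rule predicate of the (22)
instrument): a LOWER bound for the cell integral of the two-shell integrand by a double cosine substitution.  If a measurable, bounded,
non-negative `M (a, b)` minorises the integrand through the straddler's cosines (`M (cos (x+s₁)) (cos (y+s₂)) ≤ F (pt x y)` on the closed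
cell), `|sin| ≤ σ` on the two shifted coordinate intervals where `cos` is injective, the INNER cosine boxes `[A₀, A_N]`, `[β₀, β₁]` lie inside
the cosine images, and on each abscissa piece `[A_m, A_{m+1}]` the `b`-integral of `M` over `[β₀, β₁]` is at least `c_m`, then
`σₓ⁻¹ σ_y⁻¹ Σ_m c_m (A_{m+1} − A_m) ≤ ∫_cell F` (`floor2D_core`).  Ingredients: the product-measure form of cell integrability (§1), the
lower strip lemma `strip_lemma_ge` (§2: `…Subst.le_setIntegral_comp_cos` on a bounded measurable minorant, a.e. domination), adjacent
pieces (§3).  Honest framing: elementary measure theory; nothing in this file asserts a KL margin at any `t′ ≠ 0`, `K₃`, `U₀`, the window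
or B1g dominance; a Kohn–Luttinger instability statement is not ODLRO and nothing here proves superconductivity in the Hubbard model.
(p1 g26, 2026-08-29.)
-/

noncomputable section

set_option linter.dupNamespace false

namespace Summit.HubbardSuperconductivity.HubbardSuperconductivity.Theorems.KlLindhardEnclosure

open Real Set MeasureTheory Finset Literature.MathematicalPhysics.QuantumLattice
open Summit.HubbardSuperconductivity.HubbardSuperconductivity.Theorems

/-! ## §1 Cell integrability in product form -/

/-- **PRODUCT FORM OF CELL INTEGRABILITY**: `f` integrable on the grid cell ⇒ `(x, y) ↦ f (pt x y)` is integrable on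
`[a/U, b/U) × [c/U, d/U)` for `volume.prod volume` (the transfer of `…TwoShell.setIntegral_cellSet_eq_iterated`). -/
theorem Params.integrableOn_prod_of_cellSet (P : Params) {a b c d : ℤ} (f : Momentum → ℝ)
    (hF : IntegrableOn f (P.cellSet a b c d) volume) :
    IntegrableOn (fun z : ℝ × ℝ => f (pt z.1 z.2))
      (Ico ((a : ℝ) / (P.U : ℝ)) ((b : ℝ) / (P.U : ℝ)) ×ˢ Ico ((c : ℝ) / (P.U : ℝ)) ((d : ℝ) / (P.U : ℝ))) (volume.prod volume) := by
  set ra := ((P.toQ a : ℚ) : ℝ) with hra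
  set rb := ((P.toQ b : ℚ) : ℝ) with hrb
  set rc := ((P.toQ c : ℚ) : ℝ) with hrc
  set rd := ((P.toQ d : ℚ) : ℝ) with hrd
  have era : ra = (a : ℝ) / (P.U : ℝ) := P.cast_toQ a
  have erb : rb = (b : ℝ) / (P.U : ℝ) := P.cast_toQ b
  have erc : rc = (c : ℝ) / (P.U : ℝ) := P.cast_toQ c
  have erd : rd = (d : ℝ) / (P.U : ℝ) := P.cast_toQ d
  set S : Set (Fin 2 → ℝ) := (MeasurableEquiv.finTwoArrow (α := ℝ)) ⁻¹' (Ico ra rb ×ˢ Ico rc rd) with hS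
  have hcell : P.cellSet a b c d = (WithLp.ofLp : Momentum → (Fin 2 → ℝ)) ⁻¹' S := by
    rw [P.cellSet_eq_preimage, P.box_eq_preimage_prod]
  set G : (Fin 2 → ℝ) → ℝ := fun v => f (WithLp.toLp 2 v) with hG
  have hG_int : IntegrableOn G S volume := by
    have := ((PiLp.volume_preserving_ofLp (Fin 2)).integrableOn_comp_preimage
      (MeasurableEquiv.toLp 2 (Fin 2 → ℝ)).symm.measurableEmbedding (f := G) (s := S)).mp
    apply this
    rw [← hcell]
    have e : G ∘ (WithLp.ofLp : Momentum → (Fin 2 → ℝ)) = f := by funext p; simp [hG]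
    rw [e]; exact hF
  set H : ℝ × ℝ → ℝ := fun z => G ((MeasurableEquiv.finTwoArrow (α := ℝ)).symm z) with hH
  have hHG : ∀ v, H (MeasurableEquiv.finTwoArrow (α := ℝ) v) = G v := fun v => by
    simp only [hH, MeasurableEquiv.symm_apply_apply]
  have hH_int : IntegrableOn H (Ico ra rb ×ˢ Ico rc rd) (volume.prod volume) := by
    have := ((volume_preserving_finTwoArrow ℝ).integrableOn_comp_preimage
      (MeasurableEquiv.finTwoArrow (α := ℝ)).measurableEmbedding (f := H) (s := Ico ra rb ×ˢ Ico rc rd)).mp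
    have e : H ∘ (MeasurableEquiv.finTwoArrow (α := ℝ)) = G := funext hHG
    rw [e] at this
    exact this hG_int
  rw [← era, ← erb, ← erc, ← erd]
  exact hH_int

/-- Sections and marginal of the pulled-back integrand on an oriented cell: for a.e. `x ∈ [a/U, b/U]` the section `y ↦ f (pt x y)` is
integrable on `[c/U, d/U]`, and the inner integral `x ↦ ∫_{[c/U,d/U]} f (pt x y) dy` is integrable on `[a/U, b/U]`. -/
theorem Params.sections_of_cellSet (P : Params) {a b c d : ℤ} (f : Momentum → ℝ)
    (hF : IntegrableOn f (P.cellSet a b c d) volume) :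
    (∀ᵐ x ∂(volume.restrict (Icc ((a : ℝ) / (P.U : ℝ)) ((b : ℝ) / (P.U : ℝ)))),
      IntegrableOn (fun y => f (pt x y)) (Icc ((c : ℝ) / (P.U : ℝ)) ((d : ℝ) / (P.U : ℝ))) volume) ∧
    IntegrableOn (fun x => ∫ y in Icc ((c : ℝ) / (P.U : ℝ)) ((d : ℝ) / (P.U : ℝ)), f (pt x y))
      (Icc ((a : ℝ) / (P.U : ℝ)) ((b : ℝ) / (P.U : ℝ))) volume := by
  have h := P.integrableOn_prod_of_cellSet f hF
  rw [IntegrableOn, ← Measure.prod_restrict] at h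
  have hx : (volume.restrict (Icc ((a : ℝ) / (P.U : ℝ)) ((b : ℝ) / (P.U : ℝ))) : Measure ℝ) =
      volume.restrict (Ico ((a : ℝ) / (P.U : ℝ)) ((b : ℝ) / (P.U : ℝ))) := Measure.restrict_congr_set Ico_ae_eq_Icc.symm
  have hy : (volume.restrict (Icc ((c : ℝ) / (P.U : ℝ)) ((d : ℝ) / (P.U : ℝ))) : Measure ℝ) =
      volume.restrict (Ico ((c : ℝ) / (P.U : ℝ)) ((d : ℝ) / (P.U : ℝ))) := Measure.restrict_congr_set Ico_ae_eq_Icc.symm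
  constructor
  · rw [hx]
    filter_upwards [h.prod_right_ae] with x hxint
    rw [IntegrableOn, hy]; exact hxint
  · rw [IntegrableOn, hx]
    have h2 := h.integral_prod_left
    have e : (fun x => ∫ y in Icc ((c : ℝ) / (P.U : ℝ)) ((d : ℝ) / (P.U : ℝ)), f (pt x y)) =
        fun x => ∫ y in Ico ((c : ℝ) / (P.U : ℝ)) ((d : ℝ) / (P.U : ℝ)), f (pt x y) := by
      funext x; rw [setIntegral_congr_set Ico_ae_eq_Icc]
    rw [e]; exact h2

/-! ## §2 The lower strip lemma -/

/-- A bounded non-negative measurable function is integrable on every set of finite measure. -/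
theorem integrableOn_of_bdd {ℓ : ℝ → ℝ} (hℓ0 : ∀ a, 0 ≤ ℓ a) (hℓm : Measurable ℓ) {B : ℝ} (hℓB : ∀ a, ℓ a ≤ B) {t : Set ℝ}
    (ht : volume t ≠ ⊤) : IntegrableOn ℓ t volume :=
  Measure.integrableOn_of_bounded ht hℓm.aestronglyMeasurable
    (Filter.Eventually.of_forall fun a => by rw [Real.norm_of_nonneg (hℓ0 a)]; exact hℓB a)

/-- The cosine image of a closed interval has finite measure. -/
theorem volume_cos_image_ne_top (u0 u1 : ℝ) : volume (Real.cos '' Icc u0 u1) ≠ ⊤ :=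
  (lt_of_le_of_lt (measure_mono (cos_image_subset_Icc (fun x _ => ⟨Real.neg_one_le_cos x, Real.cos_le_one x⟩)))
    measure_Icc_lt_top).ne

/-- **THE LOWER STRIP LEMMA**: `|sin (x+s)| ≤ σ` on `[x0, x1]` (`0 < σ`), `cos` injective on the shifted interval, an inner box
`[A0, A1] ⊆ cos '' [x0+s, x1+s]`, a bounded measurable `ℓ ≥ 0` with `ℓ (cos (x+s)) ≤ inner x` a.e. on `[x0, x1]` for an integrable `inner`:
`σ⁻¹ · ∫_{[A0,A1]} ℓ ≤ ∫_{[x0,x1]} inner`. -/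
theorem strip_lemma_ge {x0 x1 s σ : ℝ} (hx : x0 ≤ x1) (hσ : 0 < σ)
    (hsin : ∀ x ∈ Icc x0 x1, |Real.sin (x + s)| ≤ σ) (hinj : InjOn Real.cos (Icc (x0 + s) (x1 + s)))
    {A0 A1 : ℝ} (hsub : Icc A0 A1 ⊆ Real.cos '' Icc (x0 + s) (x1 + s))
    {ℓ : ℝ → ℝ} (hℓ0 : ∀ a, 0 ≤ ℓ a) (hℓm : Measurable ℓ) {B : ℝ} (hℓB : ∀ a, ℓ a ≤ B)
    {inner : ℝ → ℝ} (hii : IntegrableOn inner (Icc x0 x1) volume)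
    (hdom : ∀ᵐ x ∂(volume.restrict (Icc x0 x1)), ℓ (Real.cos (x + s)) ≤ inner x) :
    σ⁻¹ * ∫ a in Icc A0 A1, ℓ a ≤ ∫ x in Icc x0 x1, inner x := by
  -- (1) a.e. domination on the strip
  have hℓci : IntegrableOn (fun x => ℓ (Real.cos (x + s))) (Icc x0 x1) volume :=
    Measure.integrableOn_of_bounded (measure_Icc_lt_top (μ := volume)).ne
      (hℓm.comp (by fun_prop : Measurable fun x => Real.cos (x + s))).aestronglyMeasurable
      (Filter.Eventually.of_forall fun x => by rw [Real.norm_of_nonneg (hℓ0 _)]; exact hℓB _)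
  have h1 : ∫ x in Icc x0 x1, ℓ (Real.cos (x + s)) ≤ ∫ x in Icc x0 x1, inner x := integral_mono_ae hℓci hii hdom
  -- (2) translate and substitute
  have h2 : (∫ x in Icc x0 x1, ℓ (Real.cos (x + s))) = ∫ x in Icc (x0 + s) (x1 + s), ℓ (Real.cos x) := by
    rw [integral_Icc_eq_integral_Ioc, integral_Icc_eq_integral_Ioc, ← intervalIntegral.integral_of_le hx,
      ← intervalIntegral.integral_of_le (by linarith), intervalIntegral.integral_comp_add_right (fun x => ℓ (Real.cos x)) s]
  have hsin' : ∀ x ∈ Icc (x0 + s) (x1 + s), |Real.sin x| ≤ σ := by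
    intro x hx'; have := hsin (x - s) ⟨by linarith [hx'.1], by linarith [hx'.2]⟩; simpa using this
  have hℓci' : IntegrableOn (fun x => ℓ (Real.cos x)) (Icc (x0 + s) (x1 + s)) volume :=
    Measure.integrableOn_of_bounded (measure_Icc_lt_top (μ := volume)).ne
      (hℓm.comp Real.measurable_cos).aestronglyMeasurable
      (Filter.Eventually.of_forall fun x => by rw [Real.norm_of_nonneg (hℓ0 _)]; exact hℓB _)
  have h3 := le_setIntegral_comp_cos hσ hinj hsin' hℓ0 hℓci'
  -- (3) shrink to the inner box
  have h4 := setIntegral_mono_of_subset_nonneg hsub hℓ0 (integrableOn_of_bdd hℓ0 hℓm hℓB (volume_cos_image_ne_top _ _))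
  calc σ⁻¹ * ∫ a in Icc A0 A1, ℓ a ≤ σ⁻¹ * ∫ a in Real.cos '' Icc (x0 + s) (x1 + s), ℓ a :=
        mul_le_mul_of_nonneg_left h4 (inv_nonneg.mpr hσ.le)
    _ ≤ ∫ x in Icc (x0 + s) (x1 + s), ℓ (Real.cos x) := h3
    _ ≤ ∫ x in Icc x0 x1, inner x := (le_of_eq h2.symm).trans h1

/-! ## §3 Adjacent pieces -/

/-- **PIECEWISE CONSTANT MINORANT**: monotone breakpoints `A 0 ≤ … ≤ A N`, `ℓ` integrable on the hull and `≥ c m` on piece `m`: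
`Σ_{m<N} c m · (A (m+1) − A m) ≤ ∫_{[A 0, A N]} ℓ`. -/
theorem sum_pieces_le_integral {A : ℕ → ℝ} {N : ℕ} (hmono : ∀ m, m < N → A m ≤ A (m + 1)) {c : ℕ → ℝ} {ℓ : ℝ → ℝ}
    (hℓi : IntegrableOn ℓ (Icc (A 0) (A N)) volume) (hc : ∀ m, m < N → ∀ a ∈ Icc (A m) (A (m + 1)), c m ≤ ℓ a) :
    ∑ m ∈ range N, c m * (A (m + 1) - A m) ≤ ∫ a in Icc (A 0) (A N), ℓ a := by
  have hchain : ∀ m, m ≤ N → A 0 ≤ A m ∧ A m ≤ A N := by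
    intro m hm
    constructor
    · induction m with
      | zero => exact le_rfl
      | succ k ih => exact (ih (Nat.le_of_succ_le hm)).trans (hmono k (Nat.lt_of_succ_le hm))
    · induction hm using Nat.decreasingInduction with
      | self => exact le_rfl
      | of_succ k hk ih => exact (hmono k hk).trans ih
  have h0N : A 0 ≤ A N := (hchain 0 (Nat.zero_le N)).2
  have hii : ∀ m, m < N → IntervalIntegrable ℓ volume (A m) (A (m + 1)) := by
    intro m hm
    rw [intervalIntegrable_iff_integrableOn_Icc_of_le (hmono m hm)]
    exact hℓi.mono_set fun a ha => ⟨(hchain m hm.le).1.trans ha.1, ha.2.trans (hchain (m + 1) hm).2⟩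
  rw [integral_Icc_eq_integral_Ioc, ← intervalIntegral.integral_of_le h0N,
    ← intervalIntegral.sum_integral_adjacent_intervals hii]
  refine sum_le_sum fun m hm => ?_
  have hm' := mem_range.mp hm
  have e : c m * (A (m + 1) - A m) = ∫ _ in (A m)..(A (m + 1)), c m := by
    rw [intervalIntegral.integral_const, smul_eq_mul, mul_comm]
  rw [e]
  exact intervalIntegral.integral_mono_on (hmono m hm') intervalIntegrable_const (hii m hm') (hc m hm')

/-! ## §4 The 2-D substitution floor -/

/-- **THE 2-D SUBSTITUTION FLOOR (kernel-agnostic core of the boundary floor rule)**. -/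
theorem Params.floor2D_core (P : Params) (hU : 0 < P.U) {a b c d : ℤ} (hab : a ≤ b) (hcd : c ≤ d)
    (hF : IntegrableOn P.integrand (P.cellSet a b c d) volume)
    {M : ℝ → ℝ → ℝ} (hM0 : ∀ u v, 0 ≤ M u v) {B : ℝ} (hMB : ∀ u v, M u v ≤ B) (hMm : Measurable (Function.uncurry M))
    {s1 s2 σx σy : ℝ} (hσx : 0 < σx) (hσy : 0 < σy)
    (hsinx : ∀ x ∈ Icc ((a : ℝ) / (P.U : ℝ)) ((b : ℝ) / (P.U : ℝ)), |Real.sin (x + s1)| ≤ σx)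
    (hinjx : InjOn Real.cos (Icc ((a : ℝ) / (P.U : ℝ) + s1) ((b : ℝ) / (P.U : ℝ) + s1)))
    (hsiny : ∀ y ∈ Icc ((c : ℝ) / (P.U : ℝ)) ((d : ℝ) / (P.U : ℝ)), |Real.sin (y + s2)| ≤ σy)
    (hinjy : InjOn Real.cos (Icc ((c : ℝ) / (P.U : ℝ) + s2) ((d : ℝ) / (P.U : ℝ) + s2)))
    {A : ℕ → ℝ} {N : ℕ} (hmono : ∀ m, m < N → A m ≤ A (m + 1))
    (hsubA : Icc (A 0) (A N) ⊆ Real.cos '' Icc ((a : ℝ) / (P.U : ℝ) + s1) ((b : ℝ) / (P.U : ℝ) + s1))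
    {βI0 βI1 : ℝ} (hβ : βI0 ≤ βI1)
    (hsubB : Icc βI0 βI1 ⊆ Real.cos '' Icc ((c : ℝ) / (P.U : ℝ) + s2) ((d : ℝ) / (P.U : ℝ) + s2))
    (hdom : ∀ x ∈ Icc ((a : ℝ) / (P.U : ℝ)) ((b : ℝ) / (P.U : ℝ)), ∀ y ∈ Icc ((c : ℝ) / (P.U : ℝ)) ((d : ℝ) / (P.U : ℝ)),
      M (Real.cos (x + s1)) (Real.cos (y + s2)) ≤ P.integrand (pt x y))
    {cm : ℕ → ℝ} (hc : ∀ m, m < N → ∀ u ∈ Icc (A m) (A (m + 1)), cm m ≤ ∫ v in Icc βI0 βI1, M u v) :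
    σx⁻¹ * σy⁻¹ * ∑ m ∈ range N, cm m * (A (m + 1) - A m) ≤ ∫ p in P.cellSet a b c d, P.integrand p := by
  have hU' : (0 : ℝ) < (P.U : ℝ) := by exact_mod_cast hU
  have hx01 : (a : ℝ) / (P.U : ℝ) ≤ (b : ℝ) / (P.U : ℝ) := div_le_div_of_nonneg_right (by exact_mod_cast hab) hU'.le
  have hy01 : (c : ℝ) / (P.U : ℝ) ≤ (d : ℝ) / (P.U : ℝ) := div_le_div_of_nonneg_right (by exact_mod_cast hcd) hU'.le
  -- the `b`-integral of the minorant
  set ℓ : ℝ → ℝ := fun u => ∫ v in Icc βI0 βI1, M u v with hℓ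
  have hℓ0 : ∀ u, 0 ≤ ℓ u := fun u => integral_nonneg fun v => hM0 u v
  have hB0 : 0 ≤ B := (hM0 0 0).trans (hMB 0 0)
  have hℓB : ∀ u, ℓ u ≤ B * (βI1 - βI0) := by
    intro u
    have h1 : ∫ v in Icc βI0 βI1, M u v ≤ ∫ _ in Icc βI0 βI1, B := by
      refine setIntegral_mono_on ?_ (integrableOn_const (hs := (measure_Icc_lt_top (μ := volume)).ne)) measurableSet_Icc
        fun v _ => hMB u v
      exact Measure.integrableOn_of_bounded (measure_Icc_lt_top (μ := volume)).ne
        (hMm.comp (by fun_prop : Measurable fun v : ℝ => (u, v))).aestronglyMeasurable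
        (Filter.Eventually.of_forall fun v => by
          change ‖M u v‖ ≤ B
          rw [Real.norm_of_nonneg (hM0 u v)]; exact hMB u v)
    rw [setIntegral_const, smul_eq_mul, Real.volume_real_Icc_of_le hβ, mul_comm] at h1
    exact h1
  have hℓm : Measurable ℓ := by
    have := hMm.stronglyMeasurable.integral_prod_right' (ν := volume.restrict (Icc βI0 βI1))
    exact this.measurable
  -- sections / marginal of the integrand
  obtain ⟨hsec, hmarg⟩ := P.sections_of_cellSet P.integrand hF
  set inner : ℝ → ℝ := fun x => ∫ y in Icc ((c : ℝ) / (P.U : ℝ)) ((d : ℝ) / (P.U : ℝ)), P.integrand (pt x y) with hinner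
  -- inner strips: for a.e. `x`, `σy⁻¹ ℓ (cos (x + s1)) ≤ inner x`
  have hstrip : ∀ᵐ x ∂(volume.restrict (Icc ((a : ℝ) / (P.U : ℝ)) ((b : ℝ) / (P.U : ℝ)))),
      σy⁻¹ * ℓ (Real.cos (x + s1)) ≤ inner x := by
    rw [ae_restrict_iff' measurableSet_Icc] at hsec ⊢
    filter_upwards [hsec] with x hxint hx
    have hMx : Measurable (M (Real.cos (x + s1))) := hMm.comp (by fun_prop : Measurable fun v : ℝ => (Real.cos (x + s1), v))
    have := strip_lemma_ge (A0 := βI0) (A1 := βI1) hy01 hσy hsiny hinjy hsubB (fun v => hM0 _ v) hMx (fun v => hMB _ v)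
      (hxint hx) ((ae_restrict_iff' measurableSet_Icc).mpr (Filter.Eventually.of_forall fun y hy => hdom x hx y hy))
    exact this
  -- outer strip
  have hℓ0' : ∀ u, 0 ≤ σy⁻¹ * ℓ u := fun u => mul_nonneg (inv_nonneg.mpr hσy.le) (hℓ0 u)
  have hℓB' : ∀ u, σy⁻¹ * ℓ u ≤ σy⁻¹ * (B * (βI1 - βI0)) := fun u => mul_le_mul_of_nonneg_left (hℓB u) (inv_nonneg.mpr hσy.le)
  have houter := strip_lemma_ge (A0 := A 0) (A1 := A N) hx01 hσx hsinx hinjx hsubA hℓ0' (measurable_const.mul hℓm) hℓB'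
    hmarg hstrip
  -- pieces
  have hℓi : IntegrableOn ℓ (Icc (A 0) (A N)) volume := integrableOn_of_bdd hℓ0 hℓm hℓB (measure_Icc_lt_top (μ := volume)).ne
  have hpieces := sum_pieces_le_integral hmono hℓi hc
  -- the cell integral is the iterated one
  have hcell : ∫ p in P.cellSet a b c d, P.integrand p = ∫ x in Icc ((a : ℝ) / (P.U : ℝ)) ((b : ℝ) / (P.U : ℝ)), inner x := by
    rw [P.setIntegral_cellSet_eq_iterated hU hab hcd _ hF, intervalIntegral.integral_of_le hx01, integral_Icc_eq_integral_Ioc]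
    refine setIntegral_congr_fun measurableSet_Ioc fun x _ => ?_
    show (∫ y in ((c : ℝ) / (P.U : ℝ))..((d : ℝ) / (P.U : ℝ)), P.integrand (pt x y)) = inner x
    rw [hinner, intervalIntegral.integral_of_le hy01]
    simp only
    rw [integral_Icc_eq_integral_Ioc]
  rw [hcell]
  calc σx⁻¹ * σy⁻¹ * ∑ m ∈ range N, cm m * (A (m + 1) - A m) ≤ σx⁻¹ * σy⁻¹ * ∫ u in Icc (A 0) (A N), ℓ u :=
        mul_le_mul_of_nonneg_left hpieces (mul_nonneg (inv_nonneg.mpr hσx.le) (inv_nonneg.mpr hσy.le))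
    _ = σx⁻¹ * ∫ u in Icc (A 0) (A N), σy⁻¹ * ℓ u := by rw [integral_const_mul, mul_assoc]
    _ ≤ ∫ x in Icc ((a : ℝ) / (P.U : ℝ)) ((b : ℝ) / (P.U : ℝ)), inner x := houter

end Summit.HubbardSuperconductivity.HubbardSuperconductivity.Theorems.KlLindhardEnclosure

end
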